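import Mathlib
import Summits.PneNP.PneNP.Theorems.ConvexRankGatesConvexGateBlindTestSparsity

/-!
# PneNP / ConvexRankGates — `ConvexGateBlind`: the soft-window inequality (scapegoat pairs are caught)

Helpers (`--supports stmt-PneNP-10680`), continuing `…TestCover.lean` (p89553) and `…TestSparsity.lean` (p93377).
The sparsity theorem needs `Neg_2 = ∅`: no negative PAIR marginal. A non-equivariant test may instead concentrate the
negativity that validity demands on a sparse set of "scapegoat" pairs `e` with `M(e) = -B_e ≪ 0` (uniformly planted
pairs then catch it only with probability `#Neg_2 / C(m,2)`). The SOFT WINDOW attack `a_S(Q) = C(#(Q ∩ S), 2) =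
∑_{e ⊆ S} 𝟙[e ⊆ Q]` (`S` an `s`-set) pairs with a test to `Φ(S) = ∑_{e ⊆ S} M(e)` (`softWindow`), and this file proves
the counting form of "a window around a scapegoat is negative unless it captures `B_e` of positive pair mass"
(`softWindow_markov`):
    B_e · #{S : #S = s, Φ(S) < 0} ≥ B_e · C(m-2, s-2) - P_link(e) · C(m-3, s-3) - P_far(e) · C(m-4, s-4),
where `P_link(e)` / `P_far(e)` is the positive pair mass on the pairs meeting `e` in one vertex / disjoint from `e`
(Markov over the `C(m-2,s-2)` windows containing `e`; a pair sharing a vertex with `e` lies in `C(m-3,s-3)` of them, a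
disjoint one in `C(m-4,s-4)`). Dividing by `C(m,s)`: the window of scale `s/m = ρ` catches with probability
`≳ ρ²(1 - (ρ P_link(e) + ρ² P_far(e))/B_e)`, so a design dodging soft windows and planted pairs with probability `m^{-C}` has
total negative pair mass `≤ m^{1-C/2+o(1)} ×` its positive pair mass (item evidence ANALYSIS-seat2-s5.md §9).
[elementary (Markov + double counting); new packaging]
-/

namespace Summit.PneNP.PneNP.Theorems

open Finset
open Summit.PneNP.PneNP.Cruxes.ConvexGateBlind.StrictRankConicCover (Edge)

noncomputable section

variable {m : ℕ}

/-! ## Supersets of a fixed set among the `s`-sets -/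

/-- The `s`-subsets of `Fin m` containing `A` are in bijection with the `(s - #A)`-subsets of `Aᶜ`; hence there are
`C(m - #A, s - #A)` of them (`#A ≤ s`). [folklore] -/
theorem card_filter_powersetCard_superset (A : Finset (Fin m)) {s : ℕ} (hs : A.card ≤ s) :
    (((Finset.univ : Finset (Fin m)).powersetCard s).filter (fun S => A ⊆ S)).card =
      Nat.choose (m - A.card) (s - A.card) := by
  classical
  have hcompl : (Aᶜ).card = m - A.card := by rw [card_compl, Fintype.card_fin]
  rw [← hcompl, ← card_powersetCard (s - A.card) Aᶜ]
  refine card_bij (fun S _ => S \ A) (fun S hS => ?_) (fun S₁ hS₁ S₂ hS₂ h => ?_) (fun T hT => ?_)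
  · rw [mem_filter, mem_powersetCard] at hS
    rw [mem_powersetCard]
    refine ⟨fun v hv => mem_compl.2 (mem_sdiff.1 hv).2, ?_⟩
    rw [card_sdiff_of_subset hS.2, hS.1.2]
  · rw [mem_filter] at hS₁ hS₂
    rw [← union_sdiff_of_subset hS₁.2, ← union_sdiff_of_subset hS₂.2, h]
  · rw [mem_powersetCard] at hT
    refine ⟨T ∪ A, ?_, ?_⟩
    · rw [mem_filter, mem_powersetCard]
      have hdisj : Disjoint T A := by
        rw [Finset.disjoint_left]
        intro v hvT hvA
        exact (mem_compl.1 (hT.1 hvT)) hvA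
      refine ⟨⟨subset_univ _, ?_⟩, subset_union_right⟩
      rw [card_union_of_disjoint hdisj, hT.2]
      omega
    · rw [union_sdiff_right, Finset.sdiff_eq_self_iff_disjoint]
      rw [Finset.disjoint_left]
      intro v hvT hvA
      exact (mem_compl.1 (hT.1 hvT)) hvA

/-! ## Soft windows -/

/-- The **soft window** functional of a pair function `M` at a vertex set `S`: `Φ(S) = ∑_{e ⊆ S} M(e)` — the pairing of
a test whose pair marginals are `M` with the non-negative attack `Q ↦ C(#(Q ∩ S), 2)`. [new packaging] -/
def softWindow (M : Edge m → ℝ) (S : Finset (Fin m)) : ℝ :=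
  ∑ e ∈ (Finset.univ : Finset (Edge m)).filter (fun e => edgeVerts e ⊆ S), M e

/-- Two edges with the same endpoints are equal. [folklore] -/
theorem edgeVerts_injective : Function.Injective (edgeVerts (m := m)) := by
  intro e e' h
  apply Subtype.ext
  refine Sym2.ext (fun v => ?_)
  have := congrArg (fun A : Finset (Fin m) => v ∈ A) h
  simpa [edgeVerts] using this

/-- Distinct edges span at least three vertices together. [folklore] -/
theorem three_le_card_edgeVerts_union {e e₀ : Edge m} (h : e ≠ e₀) :
    3 ≤ (edgeVerts e ∪ edgeVerts e₀).card := by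
  have hu := card_union_add_card_inter (edgeVerts e) (edgeVerts e₀)
  rw [card_edgeVerts, card_edgeVerts] at hu
  by_contra hlt
  push Not at hlt
  have hint : 2 ≤ (edgeVerts e ∩ edgeVerts e₀).card := by omega
  have h1 : edgeVerts e ∩ edgeVerts e₀ = edgeVerts e :=
    eq_of_subset_of_card_le inter_subset_left (by rw [card_edgeVerts]; exact hint)
  have h2 : edgeVerts e ∩ edgeVerts e₀ = edgeVerts e₀ :=
    eq_of_subset_of_card_le inter_subset_right (by rw [card_edgeVerts]; exact hint)
  exact h (edgeVerts_injective (h1.symm.trans h2))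

/-- Disjoint edges span four vertices together. [folklore] -/
theorem card_edgeVerts_union_of_disjoint {e e₀ : Edge m} (h : Disjoint (edgeVerts e) (edgeVerts e₀)) :
    (edgeVerts e ∪ edgeVerts e₀).card = 4 := by
  rw [card_union_of_disjoint h, card_edgeVerts, card_edgeVerts]

/-- `C(m-4, s-4) ≤ C(m-3, s-3) ≤ C(m-2, s-2)`-type monotonicity: supersets of a bigger set are fewer. [folklore] -/
theorem choose_sub_succ_le {s a : ℕ} (ha : a + 1 ≤ s) (hsm : s ≤ m) :
    Nat.choose (m - (a + 1)) (s - (a + 1)) ≤ Nat.choose (m - a) (s - a) := by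
  have h1 : m - a = (m - (a + 1)) + 1 := by omega
  have h2 : s - a = (s - (a + 1)) + 1 := by omega
  rw [h1, h2, Nat.choose_succ_succ]
  exact Nat.le_add_right _ _


open Classical in
/-- Positive pair mass on the LINK of `e₀`: `P_link(e₀) = ∑ {M(e)⁺ : e ≠ e₀, e ∩ e₀ ≠ ∅}`. [new packaging] -/
def linkMass (M : Edge m → ℝ) (e₀ : Edge m) : ℝ :=
  ∑ e ∈ (Finset.univ : Finset (Edge m)).filter (fun e => e ≠ e₀ ∧ ¬ Disjoint (edgeVerts e) (edgeVerts e₀)),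
    max (M e) 0

open Classical in
/-- Positive pair mass AWAY from `e₀`: `P_far(e₀) = ∑ {M(e)⁺ : e ∩ e₀ = ∅}`. [new packaging] -/
def farMass (M : Edge m → ℝ) (e₀ : Edge m) : ℝ :=
  ∑ e ∈ (Finset.univ : Finset (Edge m)).filter (fun e => Disjoint (edgeVerts e) (edgeVerts e₀)), max (M e) 0

/-- Positive pair mass CAPTURED by a window `S` (excluding `e₀`): `X(S) = ∑ {M(e)⁺ : e ⊆ S, e ≠ e₀}`. [new packaging] -/
def capturedPos (M : Edge m → ℝ) (e₀ : Edge m) (S : Finset (Fin m)) : ℝ :=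
  ∑ e ∈ ((Finset.univ : Finset (Edge m)).filter (fun e => edgeVerts e ⊆ S)).erase e₀, max (M e) 0

/-- Windows through `e₀` and another edge `e`: an `s`-set contains both iff it contains the union of their endpoints,
so there are `C(m - #(e ∪ e₀), s - #(e ∪ e₀))` of them; this is `C(m-3,s-3)` if `e` meets `e₀` and `C(m-4,s-4)` if not.
[folklore] -/
theorem card_windows_through_two_edges (e e₀ : Edge m) (hne : e ≠ e₀) {s : ℕ} (hs4 : 4 ≤ s) :
    ((((Finset.univ : Finset (Fin m)).powersetCard s).filter (fun S => edgeVerts e₀ ⊆ S)).filter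
        (fun S => edgeVerts e ⊆ S)).card ≤
      if Disjoint (edgeVerts e) (edgeVerts e₀) then Nat.choose (m - 4) (s - 4) else Nat.choose (m - 3) (s - 3) := by
  classical
  have hset : (((Finset.univ : Finset (Fin m)).powersetCard s).filter (fun S => edgeVerts e₀ ⊆ S)).filter
      (fun S => edgeVerts e ⊆ S) =
      ((Finset.univ : Finset (Fin m)).powersetCard s).filter (fun S => edgeVerts e ∪ edgeVerts e₀ ⊆ S) := by
    ext S
    simp only [mem_filter, union_subset_iff]
    tauto
  have hle4 : (edgeVerts e ∪ edgeVerts e₀).card ≤ 4 :=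
    (card_union_le _ _).trans (by rw [card_edgeVerts, card_edgeVerts])
  rw [hset, card_filter_powersetCard_superset _ (hle4.trans hs4)]
  split_ifs with hdisj
  · rw [card_edgeVerts_union_of_disjoint hdisj]
  · have h3 : (edgeVerts e ∪ edgeVerts e₀).card = 3 := by
      refine le_antisymm ?_ (three_le_card_edgeVerts_union hne)
      have hu := card_union_add_card_inter (edgeVerts e) (edgeVerts e₀)
      rw [card_edgeVerts, card_edgeVerts] at hu
      have hint : 1 ≤ (edgeVerts e ∩ edgeVerts e₀).card := by
        rw [Nat.one_le_iff_ne_zero, Ne, card_eq_zero, ← Ne, ← nonempty_iff_ne_empty]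
        exact not_disjoint_iff_nonempty_inter.1 hdisj
      omega
    rw [h3]

/-- **The soft-window inequality (Markov over the windows through a scapegoat pair).** Let `M` be any real function on
the edges of `K_m` (in the application: the pair marginals of a test), `e₀` an edge with `M(e₀) = -B < 0`, and
`4 ≤ s ≤ m`. Among the `C(m-2,s-2)` windows `S ⊇ e₀` of size `s`, a window with `Φ(S) = ∑_{e⊆S} M(e) ≥ 0` must capture
positive pair mass `≥ B`; summing, `B · #{S ⊇ e₀ : Φ(S) ≥ 0} ≤ ∑_{S ⊇ e₀} (captured positive mass)
= ∑_{e ≠ e₀} M(e)⁺ · #{S ⊇ e ∪ e₀} ≤ P_link(e₀) C(m-3,s-3) + P_far(e₀) C(m-4,s-4)`. Hence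
`B · #{S : #S = s, Φ(S) < 0} ≥ B · C(m-2,s-2) - P_link(e₀) · C(m-3,s-3) - P_far(e₀) · C(m-4,s-4)`.
[elementary; new packaging] -/
theorem softWindow_markov : ∀ {m : ℕ} (M : Edge m → ℝ) (e₀ : Edge m), M e₀ < 0 → ∀ {s : ℕ}, 4 ≤ s → s ≤ m →
    (-M e₀) * (Nat.choose (m - 2) (s - 2) : ℝ) - linkMass M e₀ * (Nat.choose (m - 3) (s - 3) : ℝ)
        - farMass M e₀ * (Nat.choose (m - 4) (s - 4) : ℝ) ≤
      (-M e₀) * ((((Finset.univ : Finset (Fin m)).powersetCard s).filter (fun S => softWindow M S < 0)).card : ℝ) := by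
  intro m M e₀ he₀ s hs4 _hsm
  classical
  set B := -M e₀ with hB
  have hBpos : 0 < B := by rw [hB]; linarith
  set 𝒮 := ((Finset.univ : Finset (Fin m)).powersetCard s).filter (fun S => edgeVerts e₀ ⊆ S) with h𝒮
  have hcard𝒮 : 𝒮.card = Nat.choose (m - 2) (s - 2) := by
    rw [h𝒮, card_filter_powersetCard_superset _ (by rw [card_edgeVerts]; omega), card_edgeVerts]
  -- captured positive pair mass `X = capturedPos M e₀`
  have hXnn : ∀ S, 0 ≤ capturedPos M e₀ S := fun S => Finset.sum_nonneg fun e _ => le_max_right _ _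
  -- (A) a window through `e₀` is at most `M e₀ +` its captured positive mass
  have hA : ∀ S ∈ 𝒮, softWindow M S ≤ M e₀ + capturedPos M e₀ S := by
    intro S hS
    have he₀S : e₀ ∈ (Finset.univ : Finset (Edge m)).filter (fun e => edgeVerts e ⊆ S) :=
      mem_filter.2 ⟨mem_univ _, (mem_filter.1 hS).2⟩
    unfold softWindow capturedPos
    rw [← Finset.add_sum_erase _ _ he₀S]
    exact add_le_add le_rfl (Finset.sum_le_sum fun e _ => le_max_left (M e) 0)
  -- (B) Markov: `B · #{S ∈ 𝒮 : Φ ≥ 0} ≤ ∑_{S ∈ 𝒮} capturedPos M e₀ S`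
  have hBcount : B * ((𝒮.filter (fun S => 0 ≤ softWindow M S)).card : ℝ) ≤ ∑ S ∈ 𝒮, capturedPos M e₀ S := by
    calc B * ((𝒮.filter (fun S => 0 ≤ softWindow M S)).card : ℝ)
        = ∑ _S ∈ 𝒮.filter (fun S => 0 ≤ softWindow M S), B := by rw [sum_const, nsmul_eq_mul, mul_comm]
      _ ≤ ∑ S ∈ 𝒮.filter (fun S => 0 ≤ softWindow M S), capturedPos M e₀ S := by
          refine sum_le_sum fun S hS => ?_
          obtain ⟨hS𝒮, hnn⟩ := mem_filter.1 hS
          have := hA S hS𝒮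
          rw [hB]; linarith
      _ ≤ ∑ S ∈ 𝒮, capturedPos M e₀ S := sum_le_sum_of_subset_of_nonneg (filter_subset _ _) (fun S _ _ => hXnn S)
  -- (C) swap the sums: each `e ≠ e₀` is captured by the windows through `e ∪ e₀`
  have hC : ∑ S ∈ 𝒮, capturedPos M e₀ S ≤
      linkMass M e₀ * (Nat.choose (m - 3) (s - 3) : ℝ) + farMass M e₀ * (Nat.choose (m - 4) (s - 4) : ℝ) := by
    have hswap : ∑ S ∈ 𝒮, capturedPos M e₀ S =
        ∑ e ∈ (Finset.univ : Finset (Edge m)).erase e₀,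
          max (M e) 0 * ((𝒮.filter (fun S => edgeVerts e ⊆ S)).card : ℝ) := by
      have hinner : ∀ S ∈ 𝒮, capturedPos M e₀ S =
          ∑ e ∈ (Finset.univ : Finset (Edge m)).erase e₀, if edgeVerts e ⊆ S then max (M e) 0 else 0 := by
        intro S _
        unfold capturedPos
        rw [← Finset.filter_erase, Finset.sum_filter]
      rw [Finset.sum_congr rfl hinner, Finset.sum_comm]
      refine Finset.sum_congr rfl fun e _ => ?_
      rw [Finset.sum_ite, Finset.sum_const_zero, add_zero, Finset.sum_const, nsmul_eq_mul, mul_comm]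
    rw [hswap]
    -- bound each count and split by `Disjoint`
    have hterm : ∀ e ∈ (Finset.univ : Finset (Edge m)).erase e₀,
        max (M e) 0 * ((𝒮.filter (fun S => edgeVerts e ⊆ S)).card : ℝ) ≤
          max (M e) 0 * (if Disjoint (edgeVerts e) (edgeVerts e₀) then (Nat.choose (m - 4) (s - 4) : ℝ)
            else (Nat.choose (m - 3) (s - 3) : ℝ)) := by
      intro e he
      have hne : e ≠ e₀ := (mem_erase.1 he).1
      refine mul_le_mul_of_nonneg_left ?_ (le_max_right _ _)
      have h := card_windows_through_two_edges e e₀ hne hs4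
      rw [h𝒮]
      split_ifs at h ⊢ with hd
      · exact_mod_cast h
      · exact_mod_cast h
    refine (Finset.sum_le_sum hterm).trans (le_of_eq ?_)
    rw [← Finset.sum_filter_add_sum_filter_not _ (fun e => Disjoint (edgeVerts e) (edgeVerts e₀))]
    have hfar : ∑ e ∈ ((Finset.univ : Finset (Edge m)).erase e₀).filter
          (fun e => Disjoint (edgeVerts e) (edgeVerts e₀)),
        max (M e) 0 * (if Disjoint (edgeVerts e) (edgeVerts e₀) then (Nat.choose (m - 4) (s - 4) : ℝ)
          else (Nat.choose (m - 3) (s - 3) : ℝ)) = farMass M e₀ * (Nat.choose (m - 4) (s - 4) : ℝ) := by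
      unfold farMass
      rw [Finset.sum_mul]
      have hsets : ((Finset.univ : Finset (Edge m)).erase e₀).filter (fun e => Disjoint (edgeVerts e) (edgeVerts e₀)) =
          (Finset.univ : Finset (Edge m)).filter (fun e => Disjoint (edgeVerts e) (edgeVerts e₀)) := by
        ext e
        simp only [mem_filter, mem_erase, mem_univ, true_and, and_true, ne_eq, and_iff_right_iff_imp]
        intro hd heq
        rw [heq, disjoint_self, Finset.bot_eq_empty] at hd
        have := card_edgeVerts e₀
        rw [hd, card_empty] at this
        exact absurd this (by norm_num)
      rw [hsets]
      refine Finset.sum_congr rfl fun e he => ?_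
      rw [if_pos (mem_filter.1 he).2]
    have hlink : ∑ e ∈ ((Finset.univ : Finset (Edge m)).erase e₀).filter
          (fun e => ¬ Disjoint (edgeVerts e) (edgeVerts e₀)),
        max (M e) 0 * (if Disjoint (edgeVerts e) (edgeVerts e₀) then (Nat.choose (m - 4) (s - 4) : ℝ)
          else (Nat.choose (m - 3) (s - 3) : ℝ)) = linkMass M e₀ * (Nat.choose (m - 3) (s - 3) : ℝ) := by
      unfold linkMass
      rw [Finset.sum_mul]
      have hsets : ((Finset.univ : Finset (Edge m)).erase e₀).filter
            (fun e => ¬ Disjoint (edgeVerts e) (edgeVerts e₀)) =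
          (Finset.univ : Finset (Edge m)).filter (fun e => e ≠ e₀ ∧ ¬ Disjoint (edgeVerts e) (edgeVerts e₀)) := by
        ext e
        simp only [mem_filter, mem_erase, mem_univ, true_and, and_true, ne_eq]
      rw [hsets]
      refine Finset.sum_congr rfl fun e he => ?_
      rw [if_neg (mem_filter.1 he).2.2]
    rw [hfar, hlink, add_comm]
  -- (D) combine: `#𝒮 = #{Φ ≥ 0} + #{Φ < 0}` inside `𝒮`, and the latter are negative windows
  have hsplit := Finset.card_filter_add_card_filter_not (s := 𝒮) (fun S => 0 ≤ softWindow M S)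
  have hsub : (𝒮.filter (fun S => ¬ 0 ≤ softWindow M S)).card ≤
      (((Finset.univ : Finset (Fin m)).powersetCard s).filter (fun S => softWindow M S < 0)).card := by
    refine card_le_card fun S hS => ?_
    obtain ⟨hS𝒮, hneg⟩ := mem_filter.1 hS
    exact mem_filter.2 ⟨(mem_filter.1 hS𝒮).1, not_le.1 hneg⟩
  have hsplitR : ((𝒮.filter (fun S => 0 ≤ softWindow M S)).card : ℝ) +
      ((𝒮.filter (fun S => ¬ 0 ≤ softWindow M S)).card : ℝ) = (Nat.choose (m - 2) (s - 2) : ℝ) := by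
    rw [← hcard𝒮]; exact_mod_cast hsplit
  have hsubR : B * ((𝒮.filter (fun S => ¬ 0 ≤ softWindow M S)).card : ℝ) ≤
      B * ((((Finset.univ : Finset (Fin m)).powersetCard s).filter (fun S => softWindow M S < 0)).card : ℝ) :=
    mul_le_mul_of_nonneg_left (by exact_mod_cast hsub) hBpos.le
  nlinarith [hBcount, hC, hsplitR, hsubR]


/-- **The soft window is a non-negative attack on tests.** For a test `ψ` on the `k`-sets, pairing with the attack
`a_S(Q) = #{pairs of Q inside S}` (`= C(#(Q ∩ S), 2) ≥ 0`) gives the soft window of its pair marginals: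
`∑_Q ψ(Q) · a_S(Q) = Φ(S)` with `M(e) = testMarg k ψ (edgeVerts e)`. So `Φ(S) < 0` means the window `S` CATCHES the
test in the sense of `ConvexRankGatesConvexGateBlindTestCover.lean`. [folklore double counting] -/
theorem sum_mul_pairCount_eq_softWindow (k : ℕ) (ψ : Finset (Fin m) → ℝ) (S : Finset (Fin m)) :
    ∑ Q ∈ (Finset.univ : Finset (Fin m)).powersetCard k,
        ψ Q * (((Finset.univ : Finset (Edge m)).filter (fun e => edgeVerts e ⊆ Q ∧ edgeVerts e ⊆ S)).card : ℝ) =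
      softWindow (fun e => testMarg k ψ (edgeVerts e)) S := by
  classical
  unfold softWindow testMarg
  -- expand the count as a sum of indicators and swap
  have hcount : ∀ Q : Finset (Fin m),
      (((Finset.univ : Finset (Edge m)).filter (fun e => edgeVerts e ⊆ Q ∧ edgeVerts e ⊆ S)).card : ℝ) =
        ∑ e ∈ (Finset.univ : Finset (Edge m)).filter (fun e => edgeVerts e ⊆ S),
          if edgeVerts e ⊆ Q then (1 : ℝ) else 0 := by
    intro Q
    rw [Finset.sum_ite, Finset.sum_const_zero, add_zero, Finset.sum_const, nsmul_eq_mul, mul_one, Finset.filter_filter]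
    congr 2
    ext e
    simp only [mem_filter, mem_univ, true_and]
    tauto
  simp_rw [hcount, Finset.mul_sum, mul_ite, mul_one, mul_zero]
  rw [Finset.sum_comm]
  refine Finset.sum_congr rfl fun e _ => ?_
  rw [Finset.sum_filter]

end

end Summit.PneNP.PneNP.Theorems
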